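import Summits.AtomisticToContinuum.HydrodynamicLimit.Theorems.RelayRaceLocalityNearConstantShortTimeHLSmallTiltGronwallDefs
import HarnessLib

/-!
# Crux `NearConstantShortTimeHL` (stmt-AtomisticToContinuum-12502), line `small-tilt-domination` — the energy-weighted fluctuation functional and the two re-typed inputs of the Gronwall assembly (lead c3)

Support file for the crux `…Theses.RelayRaceLocality.NearConstantShortTimeHL`, line `small-tilt-domination`, stub
`stub_gronwallAssembly` (lead prover-line-stmt-AtomisticToContinuum-12502-c3-0, continuing lead c2's skeleton v5 and blueprint
`Cruxes/NearConstantShortTimeHL/Lines/small-tilt-domination-assembly.md`). Auditing the blueprint's step (2f)–(2j) the lead found ONE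
gap, repaired here by re-typing two of the assembly's inputs (both still unproved registered stubs, so nothing landed is touched):

* On the BAD balls (mesoscale deviation `> c₀`) the flux remainder of the Dafermos identity is bounded only by the crude size of the
  Euler fluxes of the ball-averaged fields, whose energy row is CUBIC in the velocities. Truncating at a level `L`, the bounded part
  costs `L · (kinetic energy sitting in bad balls)` and the rest is the cubic tail `n⁻¹ Σᵢ ‖vᵢ‖³ 𝟙{‖vᵢ‖ > L}` along the TRUE law. With
  c2's fluctuation functional (weight `1 + ρ̃`) the energy in bad balls is itself only `≤ L² · (mass in bad balls) + tail`, so the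
  Gronwall constant grows like `L³/γ` while the tail input `TrueLawCaps` (c) (uniform integrability of the cubic current, the frame of
  `EnergyCurrentTails`, stmt-9235) has NO rate in `L`: `limsup_N D_N(t) ≤ C·t·e(L)·exp(C L³ t/γ)` need not vanish as `L → ∞`.
  REPAIR: (i) weight the fluctuation functional by the ball-averaged kinetic energy as well — `fluctuationE` below, `∫ (1 + ρ̃ + ẽ)·
  min 1 dev²`, so that mass AND kinetic energy in bad balls are `≤ fluctuationE / min(1, c₀²/3)` and the bounded cubic part costs only a
  factor `2L` (`‖v‖³ 𝟙{‖v‖ ≤ L} ≤ L ‖v‖²`); (ii) ask the tail input for GAUSSIAN velocity tails in mean along the true law, uniformly on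
  `[0, t]` — `TrueLawCapsG` (c′) below, `E[n⁻¹ Σᵢ exp(a ‖vᵢ(s)‖²)] ≤ A` for SOME `a > 0` — so that `e(L) ≤ A·C_a·e^{−aL²/2}` beats
  `exp(2 C L t/γ)` for every `t`, and the assembly closes by `N → ∞`, then `κ → 0`, then `L → ∞`. (Exponential tails `E e^{a‖v‖}` would
  close only for `t < aγ/(2C)`; mere uniform integrability never.) The statics input is re-typed accordingly:
  `MesoscaleSuperlinearityE` = c2's `MesoscaleSuperlinearity` with `fluctuation` replaced by `fluctuationE` (same heuristic: per particle
  in a bad ball the extra Gaussian factor `E e^{γ‖v‖²/2} < ∞` for `γ < θ_max⁻¹`, against the mesoscale LD cost `e^{−c n^{1/4}}` per bad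
  ball; badness CAUSED by hot particles is priced by the same Gaussian tail, `E[e^{γΣ‖vᵢ‖²/2} ; Σ‖vᵢ‖²/2 ≥ s] ≈ e^{−(θ⁻¹ − γ)s}`).
* `TrueLawCapsG` keeps (a) the speed cap `n^{1/24}` and (b) the ball-packing cap of `TrueLawCaps` VERBATIM (they are what the K-stubs'
  events carry inside) and replaces (c) by (c′). At `t = 0` (c′) is TRUE for `a < (2 θ_max)⁻¹` (Gaussian velocities given positions);
  along the true law it is the pre-shock Gaussian-tail bet (`GaussianTailsAlongEvolution`-type; barrier `HighMomentumCutoff` OPEN, not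
  evaded — the a-priori bet of every Yau-family line, here in Gaussian instead of cubic-UI currency).

No proofs here beyond three elementary properties. References: H.-T. Yau, Lett. Math. Phys. 22 (1991) §2; S. Olla – S.R.S. Varadhan –
H.-T. Yau, Comm. Math. Phys. 155 (1993) §§1, 3 (where the kinetic energy is MODIFIED to have bounded velocity precisely to avoid this
cubic-current issue); C. Kipnis – C. Landim (1999) Ch. 6.
-/

noncomputable section

namespace Summit.AtomisticToContinuum.HydrodynamicLimit.Theorems.NearConstantShortTimeHL

open scoped BigOperators ENNReal
open MeasureTheory Set Filter
open Literature.MathematicalPhysics.KineticTheory Literature.Analysis.FluidPDE Literature.Analysis.FunctionSpaces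

/-- **The energy-weighted, capped, quadratic mesoscale deviation** of a configuration `w` of `m` particles from hydrodynamic fields
`(ρ₁, u₁, θ₁)`: `∫_{𝕋³} (1 + ρ̃_w(x) + ẽ_w(x)) · min 1 (|ρ̃_w(x) − ρ₁(x)|² + ‖m̃_w(x) − ρ₁(x)u₁(x)‖² + |ẽ_w(x) − E(ρ₁,u₁,θ₁)(x)|²) dx`, with
`ρ̃, m̃, ẽ` the ball averages at radius `ℓ` (`ballKernel`). Compared with `fluctuation` (weight `1 + ρ̃`) the extra weight `ẽ` makes it
dominate the KINETIC ENERGY sitting in bad balls, which carries the cubic flux remainder there; values in `[0, 2 + n⁻¹Σ‖vᵢ‖²/2]` for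
`0 < ℓ < 1/2`. [cite: Yau1991, §2] -/
def fluctuationE {m : ℕ} (ℓ : ℝ) (ρ₁ θ₁ : T3 → ℝ) (u₁ : T3 → V3) (w : Config m (Fin 3) T3) : ℝ :=
  ∫ x, (1 + empiricalDensityField w (ballKernel ℓ x) + empiricalEnergyField w (ballKernel ℓ x)) *
    min 1 ((empiricalDensityField w (ballKernel ℓ x) - ρ₁ x) ^ 2 +
      ‖empiricalMomentumField w (ballKernel ℓ x) - ρ₁ x • u₁ x‖ ^ 2 +
      (empiricalEnergyField w (ballKernel ℓ x) - totalEnergyDensity (ρ₁ x) (u₁ x) (θ₁ x)) ^ 2)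

/-- **MESOSCALE STATIC SUPERLINEARITY, ENERGY-WEIGHTED** (statics input St2′ of `stub_gronwallAssembly`; `MesoscaleSuperlinearity` with
`fluctuation` replaced by `fluctuationE`, everything else verbatim). There is a packing threshold `η₁ > 0` such that for every box size
`M ≥ 1`, every `σ > 0` and every admissible family `(ε_N > 0, ε_N → 0, n_N ε_N³ → σ³)` there is an exponent `γ > 0` with: for every
`κ > 0`, EVENTUALLY IN `N`, simultaneously for all continuous unit-mass profiles in the box (`M⁻¹ ≤ ρ₁`, `ρ₁σ³ ≤ η₁`, `θ₁ ∈ [M⁻¹, M]`,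
`‖u₁‖ ≤ M`, all three `M`-Lipschitz) the matched canonical local Gibbs law `Q_N` (profile `localGibbsProfile (ρ₁ e^{g_σ(ρ₁)}) u₁ θ₁`)
satisfies `∫ exp(γ n_N · fluctuationE ℓ_{n_N} ρ₁ θ₁ u₁) dQ_N ≤ exp(κ n_N)`. Why true: as for `MesoscaleSuperlinearity` (balls of
`≍ n^{1/4}` particles, CLT-scale fluctuations, local LD rates linear in the ball particle number, product over `n^{3/4}` balls), the
energy weight costing per particle in a bad ball only the Gaussian factor `E e^{γ‖v‖²/2} = (1 − γθ₁)^{-3/2}` for `γ < θ₁⁻¹ ≤ M`… i.e.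
`γ < M⁻¹`, and badness caused by hot particles being paid by the same Gaussian tail. `Q_N` is the zero measure or a probability measure
(law dichotomy); for the zero measure the bound is trivial. [cite: Yau1991, §2] [cite: PulvirentiTsagkarogiannis2012, Thm 2.1] -/
@[conjecture] def MesoscaleSuperlinearityE : Prop :=
  ∃ η₁ : ℝ, 0 < η₁ ∧ ∀ M : ℝ, 1 ≤ M → ∀ σ : ℝ, 0 < σ →
    let g : ℝ → ℝ := fun r => hsExcessFreeEnergy (r * σ ^ 3) + r * σ ^ 3 * deriv hsExcessFreeEnergy (r * σ ^ 3);
    ∀ (ε : ℕ → ℝ) (n : ℕ → ℕ), (∀ N, 0 < ε N) → Tendsto ε atTop (nhds 0) →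
    Tendsto (fun N => (n N : ℝ) * ε N ^ 3) atTop (nhds (σ ^ 3)) →
    ∃ γ : ℝ, 0 < γ ∧ ∀ κ : ℝ, 0 < κ → ∀ᶠ N : ℕ in atTop,
    ∀ (ρ₁ θ₁ : T3 → ℝ) (u₁ : T3 → V3), Continuous ρ₁ → Continuous θ₁ → Continuous u₁ → (∫ x, ρ₁ x) = 1 →
    (∀ x, M⁻¹ ≤ ρ₁ x ∧ ρ₁ x * σ ^ 3 ≤ η₁ ∧ M⁻¹ ≤ θ₁ x ∧ θ₁ x ≤ M ∧ ‖u₁ x‖ ≤ M) →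
    (∀ x y, |ρ₁ x - ρ₁ y| ≤ M * dist x y ∧ ‖u₁ x - u₁ y‖ ≤ M * dist x y ∧ |θ₁ x - θ₁ y| ≤ M * dist x y) →
    let Q : Measure (Config (n N) (Fin 3) T3) :=
      (liouville (Torus.geometry (Fin 3)) (n N) (ε N)).withDensity fun z =>
        ENNReal.ofReal (canonicalDensity (Torus.geometry (Fin 3)) (ε N) (n N)
          (localGibbsProfile (fun x => ρ₁ x * Real.exp (g (ρ₁ x))) u₁ θ₁) z);
    ∫⁻ w, ENNReal.ofReal (Real.exp (γ * (n N : ℝ) * fluctuationE (mesoRadius (n N)) ρ₁ θ₁ u₁ w)) ∂Q ≤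
      ENNReal.ofReal (Real.exp (κ * (n N : ℝ)))

/-- **A-PRIORI CAPS ALONG THE TRUE LAW WITH GAUSSIAN VELOCITY TAILS, general families** (input S4′ of `stub_gronwallAssembly`;
`TrueLawCaps` with clause (c) re-typed). Same frame as `TrueLawCaps` verbatim (∀ packing-cap level `η₁ > 0`, all continuous positive
profiles, `σ` small, every admissible family, every classical hs-Euler solution on `[0,T)`, every family of flows whose canonical local
Gibbs laws are probability measures tied to the Euler data at `t = 0`, every `t < T` with nominal packing `≤ η₁/2` on `[0,t]`):
(a) the SPEED CAP `n^{1/24}` fails somewhere on `[0,t]` with probability `→ 0` (`MaxSpeedBoundPreShock`, stmt-9511),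
(b) the BALL-PACKING CAP `η₁` at radius `n^{-1/4}` fails somewhere on `[0,t]` with probability `→ 0` (`NoDenseInclusions`, stmt-14425),
(c′) GAUSSIAN VELOCITY TAILS IN MEAN, uniformly on `[0,t]`: for SOME `a > 0` and `A`, eventually in `N`,
`E_{P_N}[n⁻¹ Σᵢ exp(a ‖vᵢ(s)‖²)] ≤ A` for all `s ∈ [0,t]` — true at `t = 0` for `a < (2 sup θ₀)⁻¹` (Gaussian velocities given
positions), believed pre-shock (local Maxwellians with `θ ≤ M` plus Chapman–Enskog corrections keep Gaussian tails); it implies the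
cubic uniform integrability of `TrueLawCaps` (c) (`EnergyCurrentTails`, stmt-9235) with the RATE `e(L) ≤ A·C_a·e^{−aL²/2}` that the
Gronwall needs. Not transferable from equilibrium (sub-extensive costs); `HighMomentumCutoffBarrierNarrow` OPEN, not evaded.
[cite: Yau1991, §2] [cite: OllaVaradhanYau1993, §1] -/
@[conjecture] def TrueLawCapsG : Prop :=
  ∀ η₁ : ℝ, 0 < η₁ → ∀ (a₀ θ₀ : T3 → ℝ) (u₀ : T3 → V3), Continuous a₀ → Continuous θ₀ → Continuous u₀ →
    (∀ x, 0 < a₀ x) → (∀ x, 0 < θ₀ x) → ∃ σ₀ : ℝ, 0 < σ₀ ∧ ∀ σ : ℝ, 0 < σ → σ < σ₀ →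
    ∀ (ε : ℕ → ℝ) (n : ℕ → ℕ), (∀ N, 0 < ε N) → Tendsto ε atTop (nhds 0) →
    Tendsto (fun N => (n N : ℝ) * ε N ^ 3) atTop (nhds (σ ^ 3)) →
    ∀ (T : ℝ) (ρ θ : ℝ → T3 → ℝ) (u : ℝ → T3 → V3), IsHardSphereEulerSolution σ T ρ u θ →
    ∀ Φ : (N : ℕ) → HardSphereFlow (Torus.geometry (Fin 3)) (ε N) (n N),
    let P : (N : ℕ) → Measure (Config (n N) (Fin 3) T3) := fun N =>
      particleLaw (Φ N) (canonicalDensity (Torus.geometry (Fin 3)) (ε N) (n N) (localGibbsProfile a₀ u₀ θ₀));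
    (∀ N, IsProbabilityMeasure (P N)) →
    (∀ χ : T3 → ℝ, Continuous χ → ∀ δ : ℝ, 0 < δ →
      Tendsto (fun N => P N {z | δ < |empiricalDensityField ((Φ N).flow 0 z) χ - ∫ x, χ x * ρ 0 x|}) atTop (nhds 0) ∧
      Tendsto (fun N => P N {z | δ < ‖empiricalMomentumField ((Φ N).flow 0 z) χ - ∫ x, (χ x * ρ 0 x) • u 0 x‖}) atTop (nhds 0) ∧
      Tendsto (fun N => P N {z | δ < |empiricalEnergyField ((Φ N).flow 0 z) χ -
        ∫ x, χ x * totalEnergyDensity (ρ 0 x) (u 0 x) (θ 0 x)|}) atTop (nhds 0)) →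
    ∀ t ∈ Set.Ico 0 T, (∀ s ∈ Set.Icc 0 t, ∀ x, ρ s x * σ ^ 3 ≤ η₁ / 2) →
      Tendsto (fun N => P N {z | ∃ r ∈ Set.Icc 0 t, ∃ i, (n N : ℝ) ^ (1 / 24 : ℝ) < ‖((Φ N).flow r z i).2‖})
        atTop (nhds 0) ∧
      Tendsto (fun N => P N {z | ∃ r ∈ Set.Icc 0 t, ∃ x : T3,
        η₁ < empiricalDensityField ((Φ N).flow r z)
          (fun y => if Torus.euclidDist x y < (n N : ℝ) ^ (-(1 / 4 : ℝ))
            then (4 / 3 * Real.pi * ((n N : ℝ) ^ (-(1 / 4 : ℝ))) ^ 3)⁻¹ else 0) * σ ^ 3}) atTop (nhds 0) ∧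
      (∃ a : ℝ, 0 < a ∧ ∃ A : ℝ, ∀ᶠ N : ℕ in atTop, ∀ s ∈ Set.Icc 0 t,
        ∫⁻ z, ENNReal.ofReal ((n N : ℝ)⁻¹ * ∑ i : Fin (n N), Real.exp (a * ‖((Φ N).flow s z i).2‖ ^ 2)) ∂(P N) ≤
          ENNReal.ofReal A)

/-! ## Elementary properties -/

/-- The ball-averaged empirical kinetic energy is nonnegative. [folklore] -/
theorem ballEnergy_nonneg : ∀ {m : ℕ} (ℓ : ℝ) (x : T3) (w : Config m (Fin 3) T3), 0 ≤ empiricalEnergyField w (ballKernel ℓ x) := by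
  intro m ℓ x w
  rw [empiricalEnergyField_eq_sum]
  refine mul_nonneg (inv_nonneg.2 (Nat.cast_nonneg _)) (Finset.sum_nonneg fun i _ => ?_)
  exact mul_nonneg (ballKernel_nonneg ℓ x _) (by positivity)

/-- The energy-weighted fluctuation functional is nonnegative. [folklore] -/
theorem fluctuationE_nonneg : ∀ {m : ℕ} (ℓ : ℝ) (ρ₁ θ₁ : T3 → ℝ) (u₁ : T3 → V3) (w : Config m (Fin 3) T3), 0 ≤ fluctuationE ℓ ρ₁ θ₁ u₁ w := by
  intro m ℓ ρ₁ θ₁ u₁ w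
  unfold fluctuationE
  refine integral_nonneg fun x => mul_nonneg ?_ (le_min zero_le_one ?_)
  · linarith [ballDensity_nonneg ℓ x w, ballEnergy_nonneg ℓ x w]
  · positivity

end Summit.AtomisticToContinuum.HydrodynamicLimit.Theorems.NearConstantShortTimeHL

end
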